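import Literature.LinearAlgebra.QuadraticForm.PosComplexStructuresTorusFamilyFibreFundamentalGroup
import Literature.LinearAlgebra.QuadraticForm.PosComplexStructuresDualLocalSystems
import Literature.AlgebraicGeometry.Deligne1982.SplitWeilTypeCMTensorSections
import HarnessLib

/-!
# The monodromy of Deligne's family on `H₁(B_J, ℤ) = V(ℤ)` and `H¹(B_J, ℤ) = V(ℤ)^∨`, computed from
# the fundamental groups: conjugation in `π₁(Γ\B) ≅ V(ℤ) ⋊ Γ` acts on `π₁` of the fibre by the
# tautological representation, on its characters by the contragredient

Topic `LinearAlgebra/QuadraticForm`; sequel of `QuadraticForm/PosComplexStructuresTorusFamilyFibreFundamentalGroup`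
(the split exact sequence `1 → π₁(V/V(ℤ)) →(ι_*) π₁(Γ\B) →(p_*) π₁(Γ\X⁺) → 1` of Deligne's family
`p : Γ\B → Γ\X⁺`, `B = X⁺ × V(ℝ)/V(ℤ)`, for torsion-free `Γ` and contractible `X⁺`, under the tree's
isomorphisms `F : π₁(Γ\B) ≃* V(ℤ) ⋊ Γ` (`fundamentalGroupFamilyEquivOfContractible`),
`F_fib : π₁(V/V(ℤ)) ≃* V(ℤ)` (`fundamentalGroupLatticeTorusEquiv`), `Q : π₁(Γ\X⁺) ≃* Γ`
(`fundamentalGroupQuotientEquivOfContractible`): `F ∘ ι_* = inl ∘ F_fib`, `Q ∘ p_* = rightHom ∘ F`),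
of `QuadraticForm/PosComplexStructuresLatticeLocalSystem` (the MODEL local system `Γ\(X⁺ × V(ℤ))`, whose
monodromy is the tautological representation) and of `QuadraticForm/PosComplexStructuresDualLocalSystems`
(the contragredient `dualRep : γ ↦ ᵗ(γ⁻¹|_{V(ℤ)})` and the model of `R¹ p_* ℤ`).

SOURCES (held, read at the page). P. Deligne (notes by J. S. Milne), *Hodge cycles on abelian
varieties*, LNM 900 [Deligne1982HodgeCycles], proof of Thm. 4.8 p. 50 (held
`paper:doi-10-1007-978-3-540-38955-2-3` p0034): «`Γ` acts on `X⁺` by `J ↦ g ∘ J ∘ g⁻¹` and (compatibly)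
on `B`», `H = H₁(A, ℚ)`, «`k₁ : Aₙ(ℂ) = H₁(A, ℤ/nℤ) ⥲ V(ℤ)/nV(ℤ)`» — the fibre `B_J = V(ℝ)/V(ℤ)` has
`H₁(B_J, ℤ) = V(ℤ)` and `Γ` acts on it tautologically. A. Hatcher, *Algebraic Topology*
[HatcherAT2002] (held `book:hatchernd-algebraic-topology`): §2.A Thm. 2A.1 p. 166 (p0215) «`h : π₁(X, x₀)
→ H₁(X)` … induces an isomorphism from the abelianization of `π₁(X)` onto `H₁(X)`» — for the torus
`π₁ = V(ℤ)` is abelian, so `H₁(B_J, ℤ) = π₁(B_J)`; §3.1 p. 198 (p0256) «`H¹(X;G) ≈ Hom(H₁(X),G)` … we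
can identify `Hom(H₁(X),G)` with `Hom(π₁(X),G)` since `G` is abelian» — so `H¹(B_J, ℤ) = Hom(π₁(B_J), ℤ)`;
§1.3 Prop. 1.40 (c), Prop. 1.39. M. H. Lee, *Mixed Automorphic Forms, Torus Bundles, and Jacobi Forms*,
LNM 1845 [Lee2004] §6.1 (6.3)–(6.6) (`π₁` of the Kuga fibre variety is `Γ ⋉_ρ L`, `ρ` the
representation on the lattice). J. Carlson, S. Müller-Stach, C. Peters [CarlsonMullerStachPeters2017]
Def. 4.1.3 (the monodromy representation `ρ : π₁(S, o) → GL(H^•(X_o))`), Thm. C.4.3.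

## What is formalised (`G ≤ Γ(1) = arithmeticGroup k ψ Λ` torsion-free, `X⁺` contractible in §§3–4)

* §1 group theory: `semidirect_conj_inl` — in `N ⋊_φ H`, `x · inl(n) · x⁻¹ = inl(x.left · φ(x.right)(n) · x.left⁻¹)`;
  for commutative `N`: `= inl(φ(x.right) n)` (`semidirect_conj_inl_of_comm`) — **conjugation acts on the
  normal subgroup `N` through `φ ∘ rightHom`**; `inr_conj_inl`.
* §2 **`H₁(B_{J₀}, ℤ) = π₁(V/V(ℤ), [v₀]) ≅ V(ℤ)`**: `loopClass v₀ γ ∈ V(ℤ)` (the lattice vector of a loop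
  class, via `F_fib`), additive (`loopClass_mul/one/inv`), bijective, packaged as
  ★ `loopClassEquiv v₀ : Additive π₁(V/V(ℤ), [v₀]) ≃+ V(ℤ)`.
* §3 ★★ `conj_map_fibreInclusion_eq` / `_eq_base` / `_iff` — **for `δ ∈ π₁(Γ\B)` and a fibre loop `γ`:
  `δ · ι_*γ · δ⁻¹ = ι_*γ'` iff `loopClass γ' = Q(p_*δ) · loopClass γ`**: the action of `π₁(Γ\B)` on
  `H₁` of the fibre by conjugation factors through `p_*` and is the TAUTOLOGICAL representation of
  `Γ` on `V(ℤ)` (coordinates in `V(ℝ)`: `coe_loopClass_conj`) — for ARBITRARY `δ` and base point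
  `[(J₀, v₀)]` (the zero-section case `δ = s_*β` at `v₀ = 0` is the tree's
  `map_zeroSection_mul_map_fibreInclusion_mul_inv` of `Deligne1982/SplitWeilTypeCMKugaFamilyZeroSection`,
  with `normal_range_map_fibreInclusion` there); `conj_map_fibreInclusion_eq_of_map_familyProj_eq` (the
  action depends only on `p_*δ`); ★ `conj_map_fibreInclusion_eq_monodromy` — **the
  element of `Γ` so obtained is the monodromy element `g_β = ((fundamentalGroupToMulOpposite β).unop)⁻¹`
  of the model local system `Γ\(X⁺ × V(ℤ))`** (tree: `latticeSystemFibreEquiv_monodromy`,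
  `fundamentalGroupQuotientEquivOfContractible_apply`): the model IS `R₁ p_* ℤ` at the level of `π₁`.
* §4 **`H¹(B_{J₀}, ℤ) = Hom(π₁(B_{J₀}), ℤ) ≅ V(ℤ)^∨`**: `fibreCharacter v₀ f : π₁(V/V(ℤ)) →* ℤ`
  (`γ ↦ f(loopClass γ)`, multiplicative dress), ★ `fibreCharacterEquiv v₀ : V(ℤ)^∨ ≃ Hom(π₁(V/V(ℤ)), ℤ)`,
  and ★★ `fibreCharacter_conj` — **`(δ • χ_f)(γ) := χ_f(δ⁻¹ γ δ) = χ_{ρ^∨(Q p_* δ) f}(γ)`: `π₁(Γ\B)` acts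
  on `H¹` of the fibre through the CONTRAGREDIENT `dualRep ∘ Q ∘ p_*`** — the representation defining
  the tree's model `Γ\(X⁺ × V(ℤ)^∨)` of `R¹ p_* ℤ` (`PosComplexStructuresDualLocalSystems`);
  `dualRep_invariant_iff` (invariance under all `δ` ⟺ invariance under `G`, `Q ∘ p_*` being onto).

Definitions with bodies (`loopClass`, `loopClassEquiv`, `fibreCharacter`, `fibreCharacterEquiv`),
theorems; no `sorry`; no named facts; no instances; no notation.

## References

* [Deligne1982HodgeCycles] P. Deligne, *Hodge cycles on abelian varieties*, LNM 900, Springer 1982,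
  proof of Thm. 4.8, p. 50.
* [HatcherAT2002] A. Hatcher, *Algebraic Topology*, CUP 2002, §1.3 Prop. 1.39, 1.40; §2.A Thm. 2A.1;
  §3.1 p. 198.
* [Lee2004] M. H. Lee, *Mixed Automorphic Forms, Torus Bundles, and Jacobi Forms*, LNM 1845,
  Springer 2004, §6.1.
* [CarlsonMullerStachPeters2017] J. Carlson, S. Müller-Stach, C. Peters, *Period Mappings and Period
  Domains*, 2nd ed., CUP 2017, Def. 4.1.3, Thm. C.4.3.
* [VoisinHodgeII2003] C. Voisin, *Hodge Theory and Complex Algebraic Geometry II*, CUP 2003, §3.1.1.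
-/

noncomputable section

namespace Literature.LinearAlgebra.QuadraticForm

open Function MulAction
open Literature.Topology.CoveringSpaces

namespace arithmeticGroup

/-! ### §1 Conjugation of the normal subgroup of a semidirect product -/

section Semidirect

open SemidirectProduct

variable {N H : Type*} [Group H]

/-- **In `N ⋊_φ H`: `x · inl(n) · x⁻¹ = inl(x.left · φ(x.right)(n) · x.left⁻¹)`.**
[cite: Lee2004, §6.1 (6.3)] [cite: HatcherAT2002, §1.3 Prop. 1.40] -/
theorem semidirect_conj_inl [Group N] {φ : H →* MulAut N} (x : N ⋊[φ] H) (n : N) :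
    x * inl n * x⁻¹ = inl (x.left * φ x.right n * x.left⁻¹) := by
  ext
  · rw [mul_left, mul_left, left_inl, mul_right, right_inl, mul_one, inv_left, ← MulAut.mul_apply,
      ← map_mul, mul_inv_cancel, map_one, MulAut.one_apply, left_inl]
  · rw [mul_right, mul_right, right_inl, mul_one, inv_right, mul_inv_cancel, right_inl]

/-- **For commutative `N`, conjugation by `x ∈ N ⋊_φ H` acts on `N` as `φ(x.right)`** — the action of
the quotient `H` on the abelian normal subgroup `N` defined by the extension is `φ`.
[cite: Lee2004, §6.1 (6.3)] [cite: HatcherAT2002, §1.3 Prop. 1.40] -/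
theorem semidirect_conj_inl_of_comm [CommGroup N] {φ : H →* MulAut N} (x : N ⋊[φ] H) (n : N) :
    x * inl n * x⁻¹ = inl (φ x.right n) := by
  rw [semidirect_conj_inl, mul_inv_cancel_comm]

/-- The section form: `inr(h) · inl(n) · inr(h)⁻¹ = inl(φ(h) n)`. [cite: Lee2004, §6.1 (6.3)] -/
theorem inr_conj_inl [Group N] {φ : H →* MulAut N} (h : H) (n : N) :
    inr h * inl n * (inr h : N ⋊[φ] H)⁻¹ = inl (φ h n) := by
  rw [← map_inv, ← inl_aut]

end Semidirect

variable {V : Type*} [NormedAddCommGroup V] [NormedSpace ℝ V]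
variable {k : V →L[ℝ] V} {ψ : LinearMap.BilinForm ℝ V} {Λ : Submodule ℤ V}

/-! ### §2 `H₁(B_{J₀}, ℤ) = π₁(V/V(ℤ), [v₀]) ≅ V(ℤ)` -/

section LoopClass

variable [DiscreteTopology Λ]

/-- **The lattice vector of a loop class of the torus `V(ℝ)/V(ℤ)`** (`H₁(B_{J₀}, ℤ) = π₁ = V(ℤ)`): the
tree's `F_fib = fundamentalGroupLatticeTorusEquiv v₀ : π₁(V/V(ℤ), [v₀]) ≃* Multiplicative V(ℤ)` read in
the lattice `Λ ⊂ V`. [cite: HatcherAT2002, §2.A Thm. 2A.1, §1.3 Prop. 1.40 (c)] -/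
def loopClass (v₀ : V) (γ : FundamentalGroup (latticeTorus Λ) (v₀ : latticeTorus Λ)) : Λ :=
  ⟨((Multiplicative.toAdd (fundamentalGroupLatticeTorusEquiv v₀ γ) : Λ.toAddSubgroup) : V),
    (Multiplicative.toAdd (fundamentalGroupLatticeTorusEquiv v₀ γ)).2⟩

/-- Its coordinates in `V(ℝ)`. [cite: HatcherAT2002, §2.A Thm. 2A.1] -/
@[simp] theorem coe_loopClass (v₀ : V) (γ : FundamentalGroup (latticeTorus Λ) (v₀ : latticeTorus Λ)) :
    ((loopClass v₀ γ : Λ) : V) =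
      ((Multiplicative.toAdd (fundamentalGroupLatticeTorusEquiv v₀ γ) : Λ.toAddSubgroup) : V) := rfl

/-- As an element of `Multiplicative V(ℤ)` it is `F_fib γ`. [cite: HatcherAT2002, §2.A Thm. 2A.1] -/
theorem ofAdd_loopClass (v₀ : V) (γ : FundamentalGroup (latticeTorus Λ) (v₀ : latticeTorus Λ)) :
    (Multiplicative.ofAdd ⟨((loopClass v₀ γ : Λ) : V), (loopClass v₀ γ).2⟩ :
      Multiplicative Λ.toAddSubgroup) = fundamentalGroupLatticeTorusEquiv v₀ γ := rfl

/-- `loopClass` is additive: `[γγ'] ↦ [γ] + [γ']` (`H₁` is the abelianization of `π₁`, here `π₁`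
itself). [cite: HatcherAT2002, §2.A Thm. 2A.1] -/
theorem loopClass_mul (v₀ : V) (γ γ' : FundamentalGroup (latticeTorus Λ) (v₀ : latticeTorus Λ)) :
    loopClass v₀ (γ * γ') = loopClass v₀ γ + loopClass v₀ γ' :=
  Subtype.ext (by rw [coe_loopClass, map_mul, toAdd_mul, AddSubgroup.coe_add, Submodule.coe_add,
    coe_loopClass, coe_loopClass])

/-- `loopClass 1 = 0`. [cite: HatcherAT2002, §2.A Thm. 2A.1] -/
@[simp] theorem loopClass_one (v₀ : V) :
    loopClass v₀ (1 : FundamentalGroup (latticeTorus Λ) (v₀ : latticeTorus Λ)) = 0 :=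
  Subtype.ext (by rw [coe_loopClass, map_one, toAdd_one, AddSubgroup.coe_zero])

/-- `loopClass γ⁻¹ = -loopClass γ`. [cite: HatcherAT2002, §2.A Thm. 2A.1] -/
theorem loopClass_inv (v₀ : V) (γ : FundamentalGroup (latticeTorus Λ) (v₀ : latticeTorus Λ)) :
    loopClass v₀ γ⁻¹ = -loopClass v₀ γ :=
  Subtype.ext (by rw [coe_loopClass, map_inv, toAdd_inv, AddSubgroup.coe_neg, Submodule.coe_neg,
    coe_loopClass])

/-- `loopClass` is injective. [cite: HatcherAT2002, §1.3 Prop. 1.40 (c)] -/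
theorem injective_loopClass (v₀ : V) : Injective (loopClass (Λ := Λ) v₀) := by
  intro γ γ' h
  have h' := congrArg (fun x : Λ ↦ (x : V)) h
  simp only [coe_loopClass] at h'
  exact (fundamentalGroupLatticeTorusEquiv v₀).injective
    (Multiplicative.toAdd.injective (Subtype.ext h'))

/-- `loopClass` is surjective: every lattice vector is the class of a loop. [cite: HatcherAT2002, §1.3 Prop. 1.40 (c)] -/
theorem surjective_loopClass (v₀ : V) : Surjective (loopClass (Λ := Λ) v₀) := fun v ↦
  ⟨(fundamentalGroupLatticeTorusEquiv v₀).symm (Multiplicative.ofAdd ⟨(v : V), v.2⟩),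
    Subtype.ext (by rw [coe_loopClass, MulEquiv.apply_symm_apply, toAdd_ofAdd])⟩

/-- ★ **`H₁(B_{J₀}, ℤ) = π₁(V/V(ℤ), [v₀])^{ab} = π₁(V/V(ℤ), [v₀]) ≅ V(ℤ)`** as an additive equivalence.
[cite: HatcherAT2002, §2.A Thm. 2A.1, §1.3 Prop. 1.40 (c)] [cite: Deligne1982HodgeCycles, proof of Thm. 4.8, p. 50] -/
def loopClassEquiv (v₀ : V) : Additive (FundamentalGroup (latticeTorus Λ) (v₀ : latticeTorus Λ)) ≃+ Λ where
  toFun γ := loopClass v₀ (Additive.toMul γ)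
  invFun v := Additive.ofMul
    ((fundamentalGroupLatticeTorusEquiv v₀).symm (Multiplicative.ofAdd ⟨(v : V), v.2⟩))
  left_inv γ := by
    change Additive.ofMul ((fundamentalGroupLatticeTorusEquiv v₀).symm
      (fundamentalGroupLatticeTorusEquiv v₀ (Additive.toMul γ))) = γ
    rw [MulEquiv.symm_apply_apply, ofMul_toMul]
  right_inv v := Subtype.ext (by
    change ((loopClass v₀ _ : Λ) : V) = v
    rw [coe_loopClass, toMul_ofMul, MulEquiv.apply_symm_apply, toAdd_ofAdd])
  map_add' γ γ' := by rw [toMul_add, loopClass_mul]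

/-- Its value. [cite: HatcherAT2002, §2.A Thm. 2A.1] -/
@[simp] theorem loopClassEquiv_apply (v₀ : V)
    (γ : Additive (FundamentalGroup (latticeTorus Λ) (v₀ : latticeTorus Λ))) :
    loopClassEquiv v₀ γ = loopClass v₀ (Additive.toMul γ) := rfl

/-- Its value on `ofMul γ`. [cite: HatcherAT2002, §2.A Thm. 2A.1] -/
theorem loopClassEquiv_ofMul (v₀ : V) (γ : FundamentalGroup (latticeTorus Λ) (v₀ : latticeTorus Λ)) :
    loopClassEquiv v₀ (Additive.ofMul γ) = loopClass v₀ γ := rfl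

end LoopClass

/-! ### §3 Conjugation in `π₁(Γ\B)` acts on `H₁` of the fibre by the tautological representation -/

section TorsionFree

variable {G : Subgroup (arithmeticGroup k ψ Λ)}
variable [FiniteDimensional ℝ V] [DiscreteTopology Λ] [IsZLattice ℝ Λ]
  (htf : ∀ g : G, IsOfFinOrder g → g = 1)

/-- ★★ **Conjugation by `δ ∈ π₁(Γ\B)` on a fibre loop: `δ · ι_*γ · δ⁻¹ = ι_*(F_fib⁻¹(ρ((Fδ).right) F_fib γ))`**
— under `F : π₁(Γ\B) ≃* V(ℤ) ⋊ Γ` conjugation acts on `inl V(ℤ)` through the `Γ`-component and the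
tautological representation `ρ = latticeMulAut`. [cite: Lee2004, §6.1 (6.3)–(6.6)]
[cite: HatcherAT2002, §1.3 Prop. 1.40 (c)] [cite: Deligne1982HodgeCycles, proof of Thm. 4.8, p. 50] -/
theorem conj_map_fibreInclusion_eq [ContractibleSpace (posComplexStructures k ψ)]
    (J₀ : posComplexStructures k ψ) (v₀ : V)
    (δ : FundamentalGroup (FamilySpace k ψ Λ G) (kugaMk k ψ Λ G (J₀, v₀)))
    (γ : FundamentalGroup (latticeTorus Λ) (v₀ : latticeTorus Λ)) :
    δ * FundamentalGroup.mapOfEq ⟨fibreInclusion G J₀, continuous_fibreInclusion J₀⟩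
        (fibreInclusionCM_mk J₀ v₀) γ * δ⁻¹ =
      FundamentalGroup.mapOfEq ⟨fibreInclusion G J₀, continuous_fibreInclusion J₀⟩
        (fibreInclusionCM_mk J₀ v₀)
        ((fundamentalGroupLatticeTorusEquiv v₀).symm
          (latticeMulAut ((fundamentalGroupFamilyEquivOfContractible G htf J₀ v₀ δ).right :
            arithmeticGroup k ψ Λ) (fundamentalGroupLatticeTorusEquiv v₀ γ))) := by
  apply (fundamentalGroupFamilyEquivOfContractible G htf J₀ v₀).injective
  rw [map_mul, map_mul, map_inv, fundamentalGroupFamilyEquiv_map_fibreInclusion htf,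
    fundamentalGroupFamilyEquiv_map_fibreInclusion htf, MulEquiv.apply_symm_apply,
    semidirect_conj_inl_of_comm]
  rfl

/-- ★★ **The same through the base: `δ · ι_*γ · δ⁻¹ = ι_*(F_fib⁻¹(ρ(Q(p_* δ)) F_fib γ))`** — the action
of `π₁(Γ\B)` on `π₁ = H₁` of the fibre FACTORS THROUGH `p_* : π₁(Γ\B) → π₁(Γ\X⁺) ≅ Γ` and is the
tautological representation of `Γ` on `V(ℤ)`. [cite: Lee2004, §6.1 (6.6)] [cite: HatcherAT2002, §1.3 Prop. 1.40 (c)]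
[cite: CarlsonMullerStachPeters2017, Def. 4.1.3] [cite: Deligne1982HodgeCycles, proof of Thm. 4.8, p. 50] -/
theorem conj_map_fibreInclusion_eq_base [ContractibleSpace (posComplexStructures k ψ)]
    (J₀ : posComplexStructures k ψ) (v₀ : V)
    (δ : FundamentalGroup (FamilySpace k ψ Λ G) (kugaMk k ψ Λ G (J₀, v₀)))
    (γ : FundamentalGroup (latticeTorus Λ) (v₀ : latticeTorus Λ)) :
    δ * FundamentalGroup.mapOfEq ⟨fibreInclusion G J₀, continuous_fibreInclusion J₀⟩
        (fibreInclusionCM_mk J₀ v₀) γ * δ⁻¹ =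
      FundamentalGroup.mapOfEq ⟨fibreInclusion G J₀, continuous_fibreInclusion J₀⟩
        (fibreInclusionCM_mk J₀ v₀)
        ((fundamentalGroupLatticeTorusEquiv v₀).symm
          (latticeMulAut ((fundamentalGroupQuotientEquivOfContractible G htf J₀
            (FundamentalGroup.mapOfEq ⟨familyProj k ψ Λ G, continuous_familyProj⟩
              (familyProj_kugaMk G J₀ v₀) δ) : G) : arithmeticGroup k ψ Λ)
            (fundamentalGroupLatticeTorusEquiv v₀ γ))) := by
  rw [fundamentalGroupQuotientEquivOfContractible_map_familyProj G htf J₀ v₀ δ]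
  exact conj_map_fibreInclusion_eq htf J₀ v₀ δ γ

/-- ★★ **In the lattice: `δ · ι_*γ · δ⁻¹ = ι_*γ'` iff `loopClass γ' = Q(p_*δ) · loopClass γ`** (the
tautological action `latticeAction` of `Γ(1)` on `V(ℤ)`). [cite: Lee2004, §6.1 (6.6)]
[cite: HatcherAT2002, §1.3 Prop. 1.40 (c)] [cite: Deligne1982HodgeCycles, proof of Thm. 4.8, p. 50] -/
theorem conj_map_fibreInclusion_iff [ContractibleSpace (posComplexStructures k ψ)]
    (J₀ : posComplexStructures k ψ) (v₀ : V)
    (δ : FundamentalGroup (FamilySpace k ψ Λ G) (kugaMk k ψ Λ G (J₀, v₀)))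
    (γ γ' : FundamentalGroup (latticeTorus Λ) (v₀ : latticeTorus Λ)) :
    δ * FundamentalGroup.mapOfEq ⟨fibreInclusion G J₀, continuous_fibreInclusion J₀⟩
        (fibreInclusionCM_mk J₀ v₀) γ * δ⁻¹ =
      FundamentalGroup.mapOfEq ⟨fibreInclusion G J₀, continuous_fibreInclusion J₀⟩
        (fibreInclusionCM_mk J₀ v₀) γ' ↔
      loopClass v₀ γ' = (letI := latticeAction k ψ Λ
        (((fundamentalGroupQuotientEquivOfContractible G htf J₀
          (FundamentalGroup.mapOfEq ⟨familyProj k ψ Λ G, continuous_familyProj⟩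
            (familyProj_kugaMk G J₀ v₀) δ) : G) : arithmeticGroup k ψ Λ)) • loopClass v₀ γ) := by
  rw [conj_map_fibreInclusion_eq_base htf J₀ v₀ δ γ,
    (injective_map_fibreInclusion htf J₀ v₀).eq_iff, MulEquiv.symm_apply_eq]
  constructor
  · intro h
    apply Subtype.ext
    rw [latticeAction_smul_coe, coe_loopClass, coe_loopClass, ← h, coe_toAdd_latticeMulAut_apply]
  · intro h
    have h' := congrArg (fun x : Λ ↦ (x : V)) h
    simp only [coe_loopClass, latticeAction_smul_coe] at h'
    apply Multiplicative.toAdd.injective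
    apply Subtype.ext
    rw [coe_toAdd_latticeMulAut_apply]
    exact h'.symm

/-- **Coordinates in `V(ℝ)`**: if `δ · ι_*γ · δ⁻¹ = ι_*γ'` then the lattice vector of `γ'` is the image
of that of `γ` under the linear map `Q(p_*δ) ∈ Γ ⊂ GL(V(ℝ))`. [cite: Lee2004, §6.1 (6.6)]
[cite: CarlsonMullerStachPeters2017, Def. 4.1.3] -/
theorem coe_loopClass_conj [ContractibleSpace (posComplexStructures k ψ)]
    (J₀ : posComplexStructures k ψ) (v₀ : V)
    (δ : FundamentalGroup (FamilySpace k ψ Λ G) (kugaMk k ψ Λ G (J₀, v₀)))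
    {γ γ' : FundamentalGroup (latticeTorus Λ) (v₀ : latticeTorus Λ)}
    (h : δ * FundamentalGroup.mapOfEq ⟨fibreInclusion G J₀, continuous_fibreInclusion J₀⟩
        (fibreInclusionCM_mk J₀ v₀) γ * δ⁻¹ =
      FundamentalGroup.mapOfEq ⟨fibreInclusion G J₀, continuous_fibreInclusion J₀⟩
        (fibreInclusionCM_mk J₀ v₀) γ') :
    ((loopClass v₀ γ' : Λ) : V) =
      ((((fundamentalGroupQuotientEquivOfContractible G htf J₀
          (FundamentalGroup.mapOfEq ⟨familyProj k ψ Λ G, continuous_familyProj⟩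
            (familyProj_kugaMk G J₀ v₀) δ) : G) : arithmeticGroup k ψ Λ) : (V →L[ℝ] V)ˣ) : V →L[ℝ] V)
        (loopClass v₀ γ : V) := by
  rw [(conj_map_fibreInclusion_iff htf J₀ v₀ δ γ γ').1 h, latticeAction_smul_coe]

include htf in
/-- **The action depends only on `p_*δ`**: two classes of `π₁(Γ\B)` with the same image in `π₁(Γ\X⁺)`
conjugate fibre loops identically (the fibre group is abelian). [cite: HatcherAT2002, §1.3 Prop. 1.40 (c)]
[cite: Lee2004, §6.1 (6.6)] -/
theorem conj_map_fibreInclusion_eq_of_map_familyProj_eq [ContractibleSpace (posComplexStructures k ψ)]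
    (J₀ : posComplexStructures k ψ) (v₀ : V)
    {δ δ' : FundamentalGroup (FamilySpace k ψ Λ G) (kugaMk k ψ Λ G (J₀, v₀))}
    (h : FundamentalGroup.mapOfEq ⟨familyProj k ψ Λ G, continuous_familyProj⟩
        (familyProj_kugaMk G J₀ v₀) δ =
      FundamentalGroup.mapOfEq ⟨familyProj k ψ Λ G, continuous_familyProj⟩
        (familyProj_kugaMk G J₀ v₀) δ')
    (γ : FundamentalGroup (latticeTorus Λ) (v₀ : latticeTorus Λ)) :
    δ * FundamentalGroup.mapOfEq ⟨fibreInclusion G J₀, continuous_fibreInclusion J₀⟩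
        (fibreInclusionCM_mk J₀ v₀) γ * δ⁻¹ =
      δ' * FundamentalGroup.mapOfEq ⟨fibreInclusion G J₀, continuous_fibreInclusion J₀⟩
        (fibreInclusionCM_mk J₀ v₀) γ * δ'⁻¹ := by
  rw [conj_map_fibreInclusion_eq_base htf J₀ v₀ δ γ, conj_map_fibreInclusion_eq_base htf J₀ v₀ δ' γ, h]

/-- ★ **Agreement with the monodromy of the model local system `Γ\(X⁺ × V(ℤ))`**: for
`β = p_*δ ∈ π₁(Γ\X⁺, [J₀])`, the element `Q β ∈ Γ` by which `δ` acts on `H₁` of the fibre is the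
monodromy element `g_β = ((fundamentalGroupToMulOpposite β).unop)⁻¹` of the tree's
`latticeSystemFibreEquiv_monodromy` / `monodromy_extSystemMk`: conjugating `ι_*γ` by `δ` multiplies the
loop class by `g_β`. [cite: CarlsonMullerStachPeters2017, Def. 4.1.3, Thm. C.4.3]
[cite: HatcherAT2002, §1.3 Prop. 1.39, 1.40 (c)] [cite: Deligne1982HodgeCycles, proof of Thm. 4.8, p. 50] -/
theorem conj_map_fibreInclusion_eq_monodromy [ContractibleSpace (posComplexStructures k ψ)]
    (J₀ : posComplexStructures k ψ) (v₀ : V)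
    (δ : FundamentalGroup (FamilySpace k ψ Λ G) (kugaMk k ψ Λ G (J₀, v₀)))
    {γ γ' : FundamentalGroup (latticeTorus Λ) (v₀ : latticeTorus Λ)}
    (h : δ * FundamentalGroup.mapOfEq ⟨fibreInclusion G J₀, continuous_fibreInclusion J₀⟩
        (fibreInclusionCM_mk J₀ v₀) γ * δ⁻¹ =
      FundamentalGroup.mapOfEq ⟨fibreInclusion G J₀, continuous_fibreInclusion J₀⟩
        (fibreInclusionCM_mk J₀ v₀) γ') :
    loopClass v₀ γ' = (letI := latticeAction k ψ Λ
      (((((isQuotientCoveringMap_of_torsionFree G htf).fundamentalGroupToMulOpposite ⟨J₀, rfl⟩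
        (FundamentalGroup.mapOfEq ⟨familyProj k ψ Λ G, continuous_familyProj⟩
          (familyProj_kugaMk G J₀ v₀) δ)).unop)⁻¹ : G) : arithmeticGroup k ψ Λ) • loopClass v₀ γ) := by
  rw [← fundamentalGroupQuotientEquivOfContractible_apply htf]
  exact (conj_map_fibreInclusion_iff htf J₀ v₀ δ γ γ').1 h

end TorsionFree

/-! ### §4 `H¹(B_{J₀}, ℤ) = Hom(π₁(B_{J₀}), ℤ) ≅ V(ℤ)^∨` and the contragredient action -/

section Characters

variable [DiscreteTopology Λ]

/-- **The additive character of `π₁(V/V(ℤ), [v₀])` attached to `f ∈ V(ℤ)^∨`**: `γ ↦ f(loopClass γ)`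
(multiplicative dress `→* Multiplicative ℤ`) — an element of `H¹(B_{J₀}, ℤ) = Hom(π₁(B_{J₀}), ℤ)`.
[cite: HatcherAT2002, §3.1 p. 198, §2.A Thm. 2A.1] -/
def fibreCharacter (v₀ : V) (f : Module.Dual ℤ Λ) :
    FundamentalGroup (latticeTorus Λ) (v₀ : latticeTorus Λ) →* Multiplicative ℤ where
  toFun γ := Multiplicative.ofAdd (f (loopClass v₀ γ))
  map_one' := by rw [loopClass_one, map_zero, ofAdd_zero]
  map_mul' γ γ' := by rw [loopClass_mul, map_add, ofAdd_add]

/-- Its value. [cite: HatcherAT2002, §3.1 p. 198] -/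
@[simp] theorem fibreCharacter_apply (v₀ : V) (f : Module.Dual ℤ Λ)
    (γ : FundamentalGroup (latticeTorus Λ) (v₀ : latticeTorus Λ)) :
    fibreCharacter v₀ f γ = Multiplicative.ofAdd (f (loopClass v₀ γ)) := rfl

/-- `f ↦ χ_f` is injective (`loopClass` is onto `V(ℤ)`). [cite: HatcherAT2002, §3.1 p. 198] -/
theorem injective_fibreCharacter (v₀ : V) : Injective (fibreCharacter (Λ := Λ) v₀) := by
  intro f f' h
  ext v
  obtain ⟨γ, rfl⟩ := surjective_loopClass v₀ v
  have hγ := DFunLike.congr_fun h γ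
  rwa [fibreCharacter_apply, fibreCharacter_apply, Multiplicative.ofAdd.injective.eq_iff] at hγ

/-- ★ **`H¹(B_{J₀}, ℤ) = Hom(π₁(V/V(ℤ), [v₀]), ℤ) ≅ V(ℤ)^∨`**: every additive character of the fibre
group is `χ_f` for a unique `f ∈ Hom(V(ℤ), ℤ)`. [cite: HatcherAT2002, §3.1 p. 198, §2.A Thm. 2A.1]
[cite: Deligne1982HodgeCycles, Thm. 4.8, p. 48] -/
def fibreCharacterEquiv (v₀ : V) :
    Module.Dual ℤ Λ ≃ (FundamentalGroup (latticeTorus Λ) (v₀ : latticeTorus Λ) →* Multiplicative ℤ) where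
  toFun := fibreCharacter v₀
  invFun χ := ((MonoidHom.toAdditiveLeft χ).comp (loopClassEquiv v₀).symm.toAddMonoidHom).toIntLinearMap
  left_inv f := by
    ext v
    change f (loopClassEquiv v₀ ((loopClassEquiv v₀).symm v)) = f v
    rw [AddEquiv.apply_symm_apply]
  right_inv χ := by
    ext γ
    change Multiplicative.ofAdd
      (Multiplicative.toAdd (χ (Additive.toMul ((loopClassEquiv v₀).symm (loopClass v₀ γ))))) = χ γ
    rw [← loopClassEquiv_ofMul, AddEquiv.symm_apply_apply, toMul_ofMul, ofAdd_toAdd]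

/-- Its value. [cite: HatcherAT2002, §3.1 p. 198] -/
@[simp] theorem fibreCharacterEquiv_apply (v₀ : V) (f : Module.Dual ℤ Λ) :
    fibreCharacterEquiv v₀ f = fibreCharacter v₀ f := rfl

variable {G : Subgroup (arithmeticGroup k ψ Λ)}
variable [FiniteDimensional ℝ V] [IsZLattice ℝ Λ] (htf : ∀ g : G, IsOfFinOrder g → g = 1)

/-- ★★ **`π₁(Γ\B)` acts on `H¹(B_{J₀}, ℤ) = Hom(π₁(B_{J₀}), ℤ) ≅ V(ℤ)^∨` through the CONTRAGREDIENT
`dualRep ∘ Q ∘ p_*`**: if `γ' = δ⁻¹ · γ · δ` in the fibre group (i.e. `δ⁻¹ · ι_*γ · δ = ι_*γ'`), then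
`(δ • χ_f)(γ) := χ_f(γ') = χ_{ρ^∨(Q p_* δ) f}(γ)` with `ρ^∨(g) f = f ∘ g⁻¹|_{V(ℤ)}` — the representation
by which the tree models `R¹ p_* ℤ` as `Γ\(X⁺ × V(ℤ)^∨)` (`PosComplexStructuresDualLocalSystems`).
[cite: CarlsonMullerStachPeters2017, Def. 4.1.3, Thm. C.4.3] [cite: HatcherAT2002, §3.1 p. 198, §1.3 Prop. 1.40 (c)]
[cite: Deligne1982HodgeCycles, proof of Thm. 4.8, p. 50] -/
theorem fibreCharacter_conj [ContractibleSpace (posComplexStructures k ψ)]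
    (J₀ : posComplexStructures k ψ) (v₀ : V)
    (δ : FundamentalGroup (FamilySpace k ψ Λ G) (kugaMk k ψ Λ G (J₀, v₀))) (f : Module.Dual ℤ Λ)
    {γ γ' : FundamentalGroup (latticeTorus Λ) (v₀ : latticeTorus Λ)}
    (h : δ⁻¹ * FundamentalGroup.mapOfEq ⟨fibreInclusion G J₀, continuous_fibreInclusion J₀⟩
        (fibreInclusionCM_mk J₀ v₀) γ * δ =
      FundamentalGroup.mapOfEq ⟨fibreInclusion G J₀, continuous_fibreInclusion J₀⟩
        (fibreInclusionCM_mk J₀ v₀) γ') :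
    fibreCharacter v₀ f γ' =
      fibreCharacter v₀ (dualRep k ψ Λ ((fundamentalGroupQuotientEquivOfContractible G htf J₀
        (FundamentalGroup.mapOfEq ⟨familyProj k ψ Λ G, continuous_familyProj⟩
          (familyProj_kugaMk G J₀ v₀) δ) : G) : arithmeticGroup k ψ Λ) f) γ := by
  have h' : δ⁻¹ * FundamentalGroup.mapOfEq ⟨fibreInclusion G J₀, continuous_fibreInclusion J₀⟩
        (fibreInclusionCM_mk J₀ v₀) γ * δ⁻¹⁻¹ =
      FundamentalGroup.mapOfEq ⟨fibreInclusion G J₀, continuous_fibreInclusion J₀⟩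
        (fibreInclusionCM_mk J₀ v₀) γ' := by rwa [inv_inv]
  rw [fibreCharacter_apply, fibreCharacter_apply, (conj_map_fibreInclusion_iff htf J₀ v₀ δ⁻¹ γ γ').1 h',
    map_inv, map_inv, dualRep_apply_apply_eq_smul]
  rfl

/-- **Invariant classes**: `f ∈ V(ℤ)^∨` is fixed by the action of every `δ ∈ π₁(Γ\B)` iff it is
`Γ`-invariant, `Q ∘ p_*` being onto `Γ` — the fibre at `[J₀]` of `H⁰(Γ\X⁺, R¹ p_* ℤ) = (V(ℤ)^∨)^Γ`
(`continuousSectionsExtDualEquiv` of `PosComplexStructuresDualLocalSystems`, `d = 1`).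
[cite: VoisinHodgeII2003, §3.1.1 Cor. 3.10] [cite: CarlsonMullerStachPeters2017, Def. 4.1.3] -/
theorem dualRep_invariant_iff [ContractibleSpace (posComplexStructures k ψ)]
    (J₀ : posComplexStructures k ψ) (v₀ : V) (f : Module.Dual ℤ Λ) :
    (∀ δ : FundamentalGroup (FamilySpace k ψ Λ G) (kugaMk k ψ Λ G (J₀, v₀)),
        dualRep k ψ Λ ((fundamentalGroupQuotientEquivOfContractible G htf J₀
          (FundamentalGroup.mapOfEq ⟨familyProj k ψ Λ G, continuous_familyProj⟩
            (familyProj_kugaMk G J₀ v₀) δ) : G) : arithmeticGroup k ψ Λ) f = f) ↔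
      ∀ g : G, dualRep k ψ Λ (g : arithmeticGroup k ψ Λ) f = f := by
  constructor
  · intro h g
    obtain ⟨β, hβ⟩ := (fundamentalGroupQuotientEquivOfContractible G htf J₀).surjective g
    obtain ⟨δ, hδ⟩ := surjective_map_familyProj_of_contractibleSpace G htf J₀ v₀ β
    rw [← hβ, ← hδ]
    exact h δ
  · intro h δ
    exact h _

end Characters

end arithmeticGroup

end Literature.LinearAlgebra.QuadraticForm

end
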